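import Literature.NumberTheory.IwasawaTheory.FukudaRelationAlgebra
import Literature.NumberTheory.IwasawaTheory.ClassGroupPRankLeOneOfCardFixedLeTwoLayerTwo
import Literature.NumberTheory.IwasawaTheory.ClassGroupPRankSmallRankCriterion
import Literature.NumberTheory.IwasawaTheory.ClassicalLambdaLeStableRank
import HarnessLib

/-!
# THE RELATION DOOR: in a `ℤ_p`-tower with `p² ∤ #Cl(K_n)^{Gal(K_n/K)}`, ONE relation `∏ σ^i(c)^{f_i} = 1` on a class `c ∉ Cl^{σ−1}·Cl^p` with
# `∑ f_i X^i = (X−1)^d·u + p·g`, `p ∤ u(1)` forces `rank_p Cl(K_n) ≤ d`; with Fukuda index `0` and `d ≤ p^n − 2`: `μ = 0`, `λ ≤ d`, all ranks `≤ d`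

Topic `NumberTheory/IwasawaTheory` (namespace = path; group-theoretic brick in `Literature.NumberTheory.IwasawaTheory.FukudaRelation`).  THEOREMS ONLY
(no definition, no named fact, no instance, no `sorry`); unconditional.  Written by the prover seat `bsd-line-att-p3` g48 (cell `bsd-f1-sign2`, WIDTH-5 attach on
route `AlignedTransportAtTwo`, crux C2 stmt-BirchSwinnertonDyer-22298; `--supports`, closes nothing).  Sequel of this seat's algebra brick `FukudaRelationAlgebra`
(`#(M/pM) ≤ p^d` from one relation on a generator) and of the tree's one-layer small-rank criterion L10 (`ClassGroupPRankSmallRankCriterion`).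

THE DOOR (`classGroupPRank_le_of_relation`).  `κ` a `ℤ_p`-extension of the number field `K`, `n` a layer, `σ` a generator of `Gal(K_n/K)`, and
(1) **`p² ∤ #{c ∈ Cl(K_n) : τc = c ∀ τ}`** (at most `p` ambiguous `p`-classes — Chevalley's currency: `p ∤ h_K`, two ramified primes, the unit norm index);
(2) a class `c ∈ Cl(K_n)` **not of the form `σ(b)·b⁻¹·e^p`** (a GENERATOR of `Cl(K_n)[p^∞]` over `ℤ_p[Gal]`: by (1) the module `A = Cl(K_n)[p^∞]` has `#A/(σ−1)A = #A^σ ≤ p`,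
so `A/𝔪A ≅ 𝔽_p` and any class outside `𝔪A = (σ−1)A + pA` generates — certified downstream by ONE norm-residue symbol);
(3) **ONE RELATION `∏_{i<N} σ^i(c)^{f_i} = 1`** with the polynomial identity `∑_{i<N} f_i X^i = (X−1)^d·u + p·g` in `ℤ[X]`, `p ∤ u(1)` (i.e. `f mod p` has order `d` at
`X = 1`; for `d ≤ p^n − 2` this says: the `f_i` are NOT all congruent modulo `p`).
THEN **`rank_p Cl(K_n) ≤ d`**.  With Fukuda index `0` (`TotallyRamifiedFrom κ 0`) and `d + 2 ≤ p^n` the criterion L10 propagates: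
**`rank_p Cl(K_m) ≤ d` for every `m`, `μ(κ) = 0`, `λ(κ) ≤ d`** (`classicalMuVanishes_and_classicalLambda_le_of_relation`).

IN `Λ`-TERMS (Washington §13.3; `p ∤ h_K`, two totally ramified primes: `X = Λ/J` CYCLIC, `A_n = Λ/(J + ν_nΛ)`): the annihilator of a generator of the cyclic
module `A_n` is `J + ν_nΛ`; the relation puts `F = ∑ f_i (1+T)^i ≡ T^d·(unit) (mod p)` into it; `μ > 0 ⟺ J ⊆ pΛ` would force `F ∈ (p, ν_n) = (p, T^{p^n−1})` —
impossible for `d < p^n − 1`.  So **`μ = 0` is certified by the PRINCIPALITY of ONE ideal** (`∏ σ^i(𝔠)^{f_i} = (ξ)`, lower-bound type, any degree) instead of a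
class NUMBER, a `p`-RANK or a NON-principality of the layer field (upper-bound type).  The tree's capitulation door (`ClassicalMuVanishesLayerTwoCapitulationTwo`,
att-p3 g45) is the case `p = 2`, `n = 2`, `f = 1 + X²`.

* `FukudaRelation.natCard_pow_eq_one_le_pow_of_relation` — the door for a finite commutative group `G` with an automorphism `α`, `α^{p^t} = 1`:
  `p² ∤ #G^α`, `c ∉ G^{α−1}·G^p`, `∏_{i<N} (α^i c)^{f_i} = 1`, `∑ f_i X^i = (X−1)^d u + p g`, `p ∤ u(1)` ⟹ **`#{g : g^p = 1} ≤ p^d`**.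
* ★★★ `classGroupPRank_le_of_relation` — THE DOOR at layer `n` (no hypothesis on the tower beyond `σ` generating `Gal(K_n/K)`).
* ★★★ `classicalMuVanishes_and_classicalLambda_le_of_relation` — Fukuda index `0`, `d + 2 ≤ p^n` ⟹ `rank_p Cl(K_m) ≤ d ∀ m`, `μ = 0`, `λ ≤ d`.
* ★★★ `classicalMuVanishes_and_classicalLambda_le_of_relation_index` — Fukuda index `n₀`, relation at layer `n₀ + j`, `d + 2 ≤ p^j` ⟹ `rank_p Cl(K_m) ≤ d ∀ m ≥ n₀`, `μ = 0`, `λ ≤ d`.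

HONEST SCOPE: classical (Washington §13.3 read at finite level + Nakayama over `ℤ_p[G]` + L10); nothing specific to any summit; no certificate for any field is
asserted; BSD is not advanced by this file.  Not found in print in this form (corpus hybrid/vsearch: Lang Ch. 13 §4, Washington §13.3, Greither–Popescu (equivariant,
Fitting ideals); galaxy all: Fukuda's Kokyuroku notes on Greenberg's conjecture) — ingredients cited at each use (D-0014).

## References

* L. C. Washington, *Introduction to Cyclotomic Fields*, 2nd ed. (1997), §13.2 Lemma 13.16, §13.3 Lemmas 13.15, 13.18, Prop. 13.22–13.23. [Washington1997]
* T. Fukuda, *Remarks on `ℤ_p`-extensions of number fields*, Proc. Japan Acad. 70 A (1994), Thm. 1, p. 264. [Fukuda1994]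
* S. Lang, *Cyclotomic Fields I and II*, GTM 121 (1990), Ch. 5 §2 (Weierstrass degree), Ch. 13 §4 Lemma 4.1. [Lang1990]
* J. Neukirch, *Algebraic Number Theory* (1999), Ch. I §9 (9.6) (Galois action on ideals and classes). [NeukirchANT1999]
-/

set_option autoImplicit false

noncomputable section

open Polynomial Finset

/-! ## §1 The door for a finite commutative group with an automorphism -/

namespace Literature.NumberTheory.IwasawaTheory.FukudaRelation

section Group

variable {G : Type*} [CommGroup G] [Finite G] {p : ℕ} [hp : Fact p.Prime]

/-- An exponent `m ≡ 1 (mod p)` projecting `G` onto its `p`-primary component: `g^m ∈ G[p^∞]` for all `g`, `g^m = g` on `G[p^∞]`, `m = 1 + p·r`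
(`#G = p^s·u`, `m = u·v` with `u·v ≡ 1 (mod p^{s+1})`). [folklore] -/
private theorem exists_pow_primary_projection :
    ∃ m r : ℕ, m = 1 + p * r ∧ (∀ g : G, g ^ m ∈ CommGroup.primaryComponent G p) ∧
      (∀ g : G, g ∈ CommGroup.primaryComponent G p → g ^ m = g) := by
  classical
  haveI : Fintype G := Fintype.ofFinite G
  set h := Fintype.card G with hh
  have h0 : h ≠ 0 := Fintype.card_ne_zero
  set s := h.factorization p with hs
  set u := h / p ^ s with hu
  have hpu : Nat.Coprime u (p ^ (s + 1)) := (Nat.coprime_ordCompl hp.out h0).symm.pow_right (s + 1)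
  have hhu : p ^ s * u = h := Nat.ordProj_mul_ordCompl_eq_self h p
  have hlt : 1 < p ^ (s + 1) := Nat.one_lt_pow (by omega) hp.out.one_lt
  obtain ⟨v, -, hv⟩ := Nat.exists_mul_mod_eq_one_of_coprime hpu hlt
  set q := u * v / p ^ (s + 1) with hq
  have huv : u * v = p ^ (s + 1) * q + 1 := by
    have := Nat.div_add_mod (u * v) (p ^ (s + 1)); rw [hv] at this; exact this.symm
  refine ⟨u * v, p ^ s * q, by rw [huv]; ring, fun g => ?_, fun g hg => ?_⟩
  · refine (CommGroup.mem_primaryComponent).mpr ⟨s, ?_⟩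
    rw [← pow_mul, mul_comm (u * v), ← mul_assoc, hhu, pow_mul, hh, pow_card_eq_one, one_pow]
  · obtain ⟨k, hk⟩ := (CommGroup.mem_primaryComponent).mp hg
    -- the order of `g` divides `p^k` and `#G = p^s u`, hence `p^s`
    have hgs : g ^ p ^ s = 1 := by
      have h1 : orderOf g ∣ p ^ k := orderOf_dvd_of_pow_eq_one hk
      have h2 : orderOf g ∣ p ^ s * u := by rw [hhu, hh, ← Nat.card_eq_fintype_card]; exact orderOf_dvd_natCard g
      obtain ⟨j, -, hj⟩ := (Nat.dvd_prime_pow hp.out).mp h1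
      have h3 : p ^ j ∣ p ^ s * u := hj ▸ h2
      have h4 : p ^ j ∣ p ^ s := by
        have hcop : Nat.Coprime (p ^ j) u := (Nat.coprime_ordCompl hp.out h0).pow_left j
        exact hcop.dvd_of_dvd_mul_right h3
      exact orderOf_dvd_iff_pow_eq_one.mp (hj ▸ h4)
    rw [huv, pow_succ, pow_add, pow_one, mul_assoc, pow_mul, hgs, one_pow, one_mul]

omit hp in
/-- `#(M/f(M)) = #ker f` for an endomorphism `f` of a finite abelian group (`M/ker f ≅ f(M)`). [folklore] -/
private theorem card_quotient_range_eq_card_ker₀ {M : Type*} [AddCommGroup M] [Finite M] (f : Module.End ℤ M) :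
    Nat.card (M ⧸ LinearMap.range f) = Nat.card (LinearMap.ker f) := by
  have h1 : Nat.card (LinearMap.ker f) * Nat.card (LinearMap.range f) = Nat.card M := by
    rw [← Nat.card_congr (LinearMap.quotKerEquivRange f).toEquiv]
    exact (Submodule.card_eq_card_quotient_mul_card (LinearMap.ker f)).symm
  have h2 : Nat.card (LinearMap.range f) * Nat.card (M ⧸ LinearMap.range f) = Nat.card M :=
    (Submodule.card_eq_card_quotient_mul_card (LinearMap.range f)).symm
  have hpos : 0 < Nat.card (LinearMap.range f) := Nat.card_pos
  apply Nat.eq_of_mul_eq_mul_left hpos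
  rw [h2, ← h1, mul_comm]

omit [Finite G] hp in
/-- Iterates of an automorphism commute with powers. [folklore] -/
private theorem iterate_map_pow' (α : G ≃* G) (i : ℕ) (g : G) (m : ℕ) : (⇑α)^[i] (g ^ m) = ((⇑α)^[i] g) ^ m := by
  induction i with
  | zero => rfl
  | succ i ih => rw [Function.iterate_succ_apply', Function.iterate_succ_apply', ih, map_pow]

omit [Finite G] hp in
/-- Iterates of an automorphism commute with integer powers. [folklore] -/
private theorem iterate_map_zpow' (α : G ≃* G) (i : ℕ) (g : G) (m : ℤ) : (⇑α)^[i] (g ^ m) = ((⇑α)^[i] g) ^ m := by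
  induction i with
  | zero => rfl
  | succ i ih => rw [Function.iterate_succ_apply', Function.iterate_succ_apply', ih, map_zpow]

omit [Finite G] hp in
/-- Iterates of an automorphism are multiplicative. [folklore] -/
private theorem iterate_map_mul' (α : G ≃* G) (i : ℕ) (g g' : G) : (⇑α)^[i] (g * g') = (⇑α)^[i] g * (⇑α)^[i] g' := by
  induction i with
  | zero => rfl
  | succ i ih => rw [Function.iterate_succ_apply', Function.iterate_succ_apply', Function.iterate_succ_apply', ih, map_mul]

omit [Finite G] hp in
/-- Iterates of an automorphism send `1` to `1`. [folklore] -/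
private theorem iterate_map_one' (α : G ≃* G) (i : ℕ) : (⇑α)^[i] (1 : G) = 1 := by
  induction i with
  | zero => rfl
  | succ i ih => rw [Function.iterate_succ_apply', ih, map_one]

/-- ★★ **THE RELATION DOOR for a finite commutative group.**  `α` an automorphism of `G` with `α^{p^t} = 1`, **`p² ∤ #{g : α g = g}`**, a class
`c` **not of the form `α(b)·b⁻¹·e^p`**, and a relation **`∏_{i<N} (α^i c)^{f_i} = 1`** whose coefficient polynomial is `∑ f_i X^i = (X−1)^d·u + p·g` with
`p ∤ u(1)`.  THEN **`#{g : g^p = 1} ≤ p^d`** (the `p`-rank of `G` is at most `d`).  On `P = G[p^∞]` with `φ = α|_P`: `#P/(φ−1)P = #P^φ ≤ p`, the projection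
`c^m` of `c` (`m ≡ 1 mod p`) lies outside `𝔪P` and satisfies the same relation, and the relation lemma gives `#P/pP ≤ p^d`.
[cite: Washington1997, §13.3 Lemmas 13.15, 13.18 and Prop. 13.22–13.23] [cite: Lang1990, Ch. 13 §4 Lemma 4.1] -/
theorem natCard_pow_eq_one_le_pow_of_relation (α : G ≃* G) {t : ℕ} (hα : ∀ g, (⇑α)^[p ^ t] g = g)
    (hfix : ¬ p ^ 2 ∣ Nat.card {g : G // α g = g}) {c : G} (hc : ¬ ∃ b e : G, c = α b / b * e ^ p)
    {N d : ℕ} {f : ℕ → ℤ} {u g : ℤ[X]} (hu : ¬ (p : ℤ) ∣ u.eval 1)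
    (hF : (∑ i ∈ range N, C (f i) * X ^ i : ℤ[X]) = (X - 1) ^ d * u + C (p : ℤ) * g)
    (hrel : ∏ i ∈ range N, ((⇑α)^[i] c) ^ (f i) = 1) :
    Nat.card {g : G // g ^ p = 1} ≤ p ^ d := by
  classical
  set P : Subgroup G := CommGroup.primaryComponent G p with hP
  have hPmem : ∀ {g : G}, g ∈ P ↔ ∃ k : ℕ, g ^ p ^ k = 1 := fun {g} => CommGroup.mem_primaryComponent
  -- `α` restricted to `P`
  have hαP : ∀ g : P, α (g : G) ∈ P := fun g => by
    obtain ⟨k, hk⟩ := hPmem.mp g.2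
    exact hPmem.mpr ⟨k, by rw [← map_pow, hk, map_one]⟩
  let αP : P →* P :=
    { toFun := fun g => ⟨α g, hαP g⟩
      map_one' := Subtype.ext (by simp)
      map_mul' := fun a b => Subtype.ext (by simp) }
  have hαP_apply : ∀ g : P, ((αP g : P) : G) = α g := fun _ => rfl
  -- additive module `M = P`, `φ = α|_P`
  let φ : Module.End ℤ (Additive P) := (MonoidHom.toAdditive αP).toIntLinearMap
  have hφ_apply : ∀ x : Additive P, φ x = Additive.ofMul (αP (Additive.toMul x)) := fun _ => rfl
  -- iterates: `(φ^i x : G) = α^i (x : G)`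
  have hφi : ∀ (i : ℕ) (x : Additive P), ((Additive.toMul ((φ ^ i) x) : P) : G) = (⇑α)^[i] ((Additive.toMul x : P) : G) := by
    intro i
    induction i with
    | zero => intro x; rfl
    | succ i ih =>
      intro x
      rw [pow_succ', Module.End.mul_apply, Function.iterate_succ_apply', ← ih x, hφ_apply, toMul_ofMul, hαP_apply]
  have hφt : φ ^ p ^ t = 1 := by
    apply LinearMap.ext
    intro x
    rw [Module.End.one_apply]
    apply Additive.toMul.injective
    apply Subtype.ext
    rw [hφi, hα]
  have hM : ∃ a : ℕ, Nat.card (Additive P) = p ^ a := (CommGroup.primaryComponent.isPGroup (G := G) (p := p)).exists_card_eq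
  set π : Module.End ℤ (Additive P) := (p : ℤ) • 1 with hπ
  have hπ_apply : ∀ x : Additive P, π x = (p : ℤ) • x := fun _ => rfl
  -- (1) `#ker(φ − 1) ≤ p`, hence `#(P/((φ−1)P + pP)) ≤ p`
  have h1 : Nat.card (LinearMap.ker (φ - 1)) ≤ p := by
    let Fix : Subgroup G :=
      { carrier := {g | α g = g}
        mul_mem' := fun {a b} ha hb => by
          simp only [Set.mem_setOf_eq] at ha hb ⊢
          rw [map_mul, ha, hb]
        one_mem' := by simp
        inv_mem' := fun {a} ha => by
          simp only [Set.mem_setOf_eq] at ha ⊢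
          rw [map_inv, ha] }
    have hFix : Nat.card Fix = Nat.card {g : G // α g = g} := Nat.card_congr (Equiv.subtypeEquivRight fun _ => Iff.rfl)
    have hiff : ∀ x : Additive P, x ∈ LinearMap.ker (φ - 1) ↔ ((Additive.toMul x : P) : G) ∈ P ⊓ Fix := by
      intro x
      rw [LinearMap.mem_ker, LinearMap.sub_apply, Module.End.one_apply, sub_eq_zero, Subgroup.mem_inf]
      constructor
      · intro h
        refine ⟨(Additive.toMul x).2, ?_⟩
        change α ((Additive.toMul x : P) : G) = _
        have := congrArg (fun y : Additive P => ((Additive.toMul y : P) : G)) h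
        simpa only [hφ_apply, toMul_ofMul, hαP_apply] using this
      · rintro ⟨-, h⟩
        change α ((Additive.toMul x : P) : G) = ((Additive.toMul x : P) : G) at h
        apply Additive.toMul.injective
        exact Subtype.ext (by simp only [hφ_apply, toMul_ofMul, hαP_apply, h])
    let e : LinearMap.ker (φ - 1) ≃ (P ⊓ Fix : Subgroup G) :=
      { toFun := fun x => ⟨((Additive.toMul (x : Additive P) : P) : G), (hiff x.1).mp x.2⟩
        invFun := fun g => ⟨Additive.ofMul ⟨(g : G), (Subgroup.mem_inf.mp g.2).1⟩, (hiff _).mpr (by simp only [toMul_ofMul]; exact g.2)⟩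
        left_inv := fun x => by apply Subtype.ext; apply Additive.toMul.injective; exact Subtype.ext rfl
        right_inv := fun g => Subtype.ext rfl }
    rw [Nat.card_congr e]
    obtain ⟨n, hn⟩ := ((CommGroup.primaryComponent.isPGroup (G := G) (p := p)).to_le
      (inf_le_left : P ⊓ Fix ≤ P)).exists_card_eq
    have hdvd : Nat.card (P ⊓ Fix : Subgroup G) ∣ Nat.card Fix := Subgroup.card_dvd_of_le inf_le_right
    rw [hn, hFix] at hdvd
    rw [hn]
    rcases Nat.lt_or_ge n 2 with hn2 | hn2
    · interval_cases n
      · rw [pow_zero]; exact hp.out.one_lt.le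
      · rw [pow_one]
    · exact absurd ((pow_dvd_pow p hn2).trans hdvd) hfix
  have hQ : Nat.card (Additive P ⧸ ((⊤ : Submodule ℤ (Additive P)).map π ⊔ (⊤ : Submodule ℤ (Additive P)).map (φ - 1))) ≤ p := by
    have hle : (⊤ : Submodule ℤ (Additive P)).map (φ - 1) ≤
        (⊤ : Submodule ℤ (Additive P)).map π ⊔ (⊤ : Submodule ℤ (Additive P)).map (φ - 1) := le_sup_right
    refine (MuZeroRank.card_quotient_le_of_le hle).trans ?_
    rw [Submodule.map_top, card_quotient_range_eq_card_ker₀]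
    exact h1
  -- (2) the projection `x₀ = c^m` of `c` to `P`, outside `𝔪P`
  obtain ⟨m, r, hm, hmem, hid⟩ := exists_pow_primary_projection (G := G) (p := p)
  set x₀ : Additive P := Additive.ofMul ⟨c ^ m, hmem c⟩ with hx₀def
  have hx₀G : ((Additive.toMul x₀ : P) : G) = c ^ m := rfl
  have hx₀ : x₀ ∉ (⊤ : Submodule ℤ (Additive P)).map π ⊔ (⊤ : Submodule ℤ (Additive P)).map (φ - 1) := by
    intro hx
    obtain ⟨y, hy, z, hz, hyz⟩ := Submodule.mem_sup.mp hx
    obtain ⟨y', -, rfl⟩ := Submodule.mem_map.mp hy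
    obtain ⟨z', -, rfl⟩ := Submodule.mem_map.mp hz
    apply hc
    -- `c^m = y'^p · α(z') · z'⁻¹` in `G`
    have hG : c ^ m = ((Additive.toMul y' : P) : G) ^ (p : ℤ) * (α ((Additive.toMul z' : P) : G) / ((Additive.toMul z' : P) : G)) := by
      have h : ((Additive.toMul (π y' + (φ - 1) z') : P) : G) = ((Additive.toMul x₀ : P) : G) := by rw [hyz]
      rw [hx₀G] at h
      rw [← h, toMul_add, Subgroup.coe_mul, hπ_apply, toMul_zsmul, SubgroupClass.coe_zpow, LinearMap.sub_apply,
        Module.End.one_apply, toMul_sub, Subgroup.coe_div, hφ_apply, toMul_ofMul, hαP_apply]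
    -- `c = c^m · (c^r)^{-p}`
    refine ⟨((Additive.toMul z' : P) : G), ((Additive.toMul y' : P) : G) * (c ^ r)⁻¹, ?_⟩
    have hcm : c = c ^ m * ((c ^ r)⁻¹) ^ p := by
      rw [hm, mul_comm p r, pow_add, pow_one, pow_mul, inv_pow, mul_inv_cancel_right]
    calc c = c ^ m * ((c ^ r)⁻¹) ^ p := hcm
      _ = ((Additive.toMul y' : P) : G) ^ (p : ℤ) * (α ((Additive.toMul z' : P) : G) / ((Additive.toMul z' : P) : G)) *
            ((c ^ r)⁻¹) ^ p := by rw [hG]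
      _ = α ((Additive.toMul z' : P) : G) / ((Additive.toMul z' : P) : G) * (((Additive.toMul y' : P) : G) * (c ^ r)⁻¹) ^ p := by
          rw [mul_pow, zpow_natCast]; ac_rfl
  -- (3) the relation for `x₀`
  have hrel' : ∑ i ∈ range N, f i • (φ ^ i) x₀ = 0 := by
    apply Additive.toMul.injective
    apply Subtype.ext
    rw [toMul_sum, toMul_zero, SubmonoidClass.coe_finsetProd, Subgroup.coe_one]
    have hterm : ∀ i ∈ range N, ((Additive.toMul (f i • (φ ^ i) x₀) : P) : G) = (((⇑α)^[i] c) ^ (f i)) ^ m := by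
      intro i _
      rw [toMul_zsmul, SubgroupClass.coe_zpow, hφi, hx₀G, iterate_map_pow', ← zpow_natCast, ← zpow_mul, ← zpow_natCast,
        ← zpow_mul, mul_comm]
    rw [Finset.prod_congr rfl hterm, Finset.prod_pow, hrel, one_pow]
  -- (4) the relation lemma: `#(P/pP) ≤ p^d`
  have h3 := card_quotient_smul_le_pow_of_sum_smul_pow_apply_eq_zero hM φ hφt hQ hx₀ hu hF hrel'
  -- `{g : g^p = 1} ≃ ker π`, `#ker π = #(P/pP)`
  have hkerπ : Nat.card (LinearMap.ker π) = Nat.card (Additive P ⧸ (⊤ : Submodule ℤ (Additive P)).map π) := by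
    rw [Submodule.map_top, card_quotient_range_eq_card_ker₀]
  have hsq : ∀ {g : G}, g ^ p = 1 → g ∈ P := fun {g} hg => hPmem.mpr ⟨1, by rw [pow_one]; exact hg⟩
  have hiff2 : ∀ x : Additive P, x ∈ LinearMap.ker π ↔ ((Additive.toMul x : P) : G) ^ p = 1 := by
    intro x
    rw [LinearMap.mem_ker, hπ_apply, show ((p : ℤ) • x = 0 ↔ (p : ℕ) • x = 0) from by rw [← natCast_zsmul]]
    constructor
    · intro h
      have h' : (Additive.toMul x : P) ^ p = 1 := by
        have := congrArg Additive.toMul h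
        rwa [toMul_nsmul, toMul_zero] at this
      have := congrArg (fun z : P => (z : G)) h'
      simpa using this
    · intro h
      have h' : (Additive.toMul x : P) ^ p = 1 := Subtype.ext (by simpa using h)
      have := congrArg Additive.ofMul h'
      rwa [ofMul_pow, ofMul_toMul, ofMul_one] at this
  let e2 : {g : G // g ^ p = 1} ≃ LinearMap.ker π :=
    { toFun := fun g => ⟨Additive.ofMul ⟨(g : G), hsq g.2⟩, (hiff2 _).mpr (by simpa using g.2)⟩
      invFun := fun x => ⟨((Additive.toMul (x : Additive P) : P) : G), (hiff2 x.1).mp x.2⟩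
      left_inv := fun g => Subtype.ext rfl
      right_inv := fun x => by apply Subtype.ext; apply Additive.toMul.injective; exact Subtype.ext rfl }
  rw [Nat.card_congr e2, hkerπ]
  exact h3

end Group

end Literature.NumberTheory.IwasawaTheory.FukudaRelation

/-! ## §2 The door in a `ℤ_p`-tower -/

namespace Literature.NumberTheory.IwasawaTheory

open scoped NumberField
open NumberField Field Literature.NumberTheory.EllipticCurves Literature.NumberTheory.NumberFields
  Literature.NumberTheory.GaloisRepresentations

section Door

variable {K : Type} [Field K] [NumberField K] {p : ℕ} [hp : Fact p.Prime]

/-- ★★★ **THE RELATION DOOR (one layer).**  `κ` a `ℤ_p`-extension of the number field `K`, `n` a layer, `σ` a generator of `Gal(K_n/K)`;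
**`p² ∤ #{c ∈ Cl(K_n) : τc = c ∀ τ}`**; a class `c` **not of the form `σ(b)·b⁻¹·e^p`**; and **ONE RELATION `∏_{i<N} σ^i(c)^{f_i} = 1`** whose coefficient
polynomial is `∑ f_i X^i = (X−1)^d·u + p·g`, `p ∤ u(1)`.  THEN **`rank_p Cl(K_n) ≤ d`**.  (`Cl(K_n)[p^∞]` is a cyclic `ℤ_p[Gal]`-module generated by the `p`-part of
`c`; the relation has order `d` at `σ = 1` modulo `p`; the relation lemma.) [cite: Washington1997, §13.3 Lemmas 13.15, 13.18 and Prop. 13.22–13.23]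
[cite: NeukirchANT1999, Ch. I §9 (9.6)] [cite: Lang1990, Ch. 13 §4 Lemma 4.1] -/
theorem classGroupPRank_le_of_relation (κ : ZpExtension K p) (n : ℕ) (σ : (κ.layer n) ≃ₐ[K] (κ.layer n))
    (hσ : ∀ τ : (κ.layer n) ≃ₐ[K] (κ.layer n), τ ∈ Subgroup.zpowers σ)
    (hfix : ¬ p ^ 2 ∣ Nat.card {c : ClassGroup (𝓞 (κ.layer n)) //
        ∀ τ : (κ.layer n) ≃ₐ[K] (κ.layer n), ClassGroup.mulEquiv (AmbiguousClass.intAut τ) c = c})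
    {c : ClassGroup (𝓞 (κ.layer n))}
    (hc : ¬ ∃ b e : ClassGroup (𝓞 (κ.layer n)), c = ClassGroup.mulEquiv (AmbiguousClass.intAut σ) b / b * e ^ p)
    {N d : ℕ} {f : ℕ → ℤ} {u g : ℤ[X]} (hu : ¬ (p : ℤ) ∣ u.eval 1)
    (hF : (∑ i ∈ range N, C (f i) * X ^ i : ℤ[X]) = (X - 1) ^ d * u + C (p : ℤ) * g)
    (hrel : ∏ i ∈ range N, (ClassGroup.mulEquiv (AmbiguousClass.intAut (σ ^ i)) c) ^ (f i) = 1) :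
    classGroupPRank κ n ≤ d := by
  classical
  haveI : FiniteDimensional K (κ.layer n) := κ.finiteDimensional_layer_holds n
  haveI : NumberField (κ.layer n) := NumberField.of_module_finite K _
  haveI : IsGalois K (κ.layer n) := κ.isGalois_layer_holds n
  let α : ClassGroup (𝓞 (κ.layer n)) ≃* ClassGroup (𝓞 (κ.layer n)) := ClassGroup.mulEquiv (AmbiguousClass.intAut σ)
  have hα : ∀ x, α x = ClassGroup.mulEquiv (AmbiguousClass.intAut σ) x := fun _ => rfl
  -- iterates of `α` are the powers of `σ`
  have hpow : ∀ (k : ℕ) (x : ClassGroup (𝓞 (κ.layer n))), (⇑α)^[k] x = ClassGroup.mulEquiv (AmbiguousClass.intAut (σ ^ k)) x := by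
    intro k
    induction k with
    | zero => intro x; rw [Function.iterate_zero, id, pow_zero, AmbiguousClass.mulEquiv_intAut_one, MulEquiv.refl_apply]
    | succ k ih =>
      intro x
      rw [Function.iterate_succ_apply', ih, pow_succ', AmbiguousClass.mulEquiv_intAut_mul, MulEquiv.trans_apply]
  -- `σ^{p^n} = 1`
  have hσord : σ ^ p ^ n = 1 := by
    have h := pow_card_eq_one' (G := (κ.layer n) ≃ₐ[K] (κ.layer n)) (x := σ)
    rwa [IsGalois.card_aut_eq_finrank, κ.finrank_layer_holds n] at h
  have hαt : ∀ x, (⇑α)^[p ^ n] x = x := fun x => by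
    rw [hpow, hσord, AmbiguousClass.mulEquiv_intAut_one, MulEquiv.refl_apply]
  -- the `σ`-fixed classes are the `Gal(K_n/K)`-fixed classes
  have hfixα : ¬ p ^ 2 ∣ Nat.card {x : ClassGroup (𝓞 (κ.layer n)) // α x = x} := by
    have hcard : Nat.card {x : ClassGroup (𝓞 (κ.layer n)) //
        ∀ τ : (κ.layer n) ≃ₐ[K] (κ.layer n), ClassGroup.mulEquiv (AmbiguousClass.intAut τ) x = x} =
        Nat.card {x : ClassGroup (𝓞 (κ.layer n)) // α x = x} := by
      refine Nat.card_congr (Equiv.subtypeEquivRight fun x => ⟨fun h => h σ, fun h τ => ?_⟩)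
      obtain ⟨k, rfl⟩ := Herbrand.exists_pow_eq_of_forall_mem_zpowers hσ τ
      rw [← hpow]
      induction k with
      | zero => rfl
      | succ k ih => rw [Function.iterate_succ_apply', ih]; exact h
    rwa [hcard] at hfix
  have hrel' : ∏ i ∈ range N, ((⇑α)^[i] c) ^ (f i) = 1 := by
    rw [← hrel]; exact Finset.prod_congr rfl fun i _ => by rw [hpow]
  have h := FukudaRelation.natCard_pow_eq_one_le_pow_of_relation α hαt hfixα hc hu hF hrel'
  rw [natCard_torsion_classGroup_layer_eq κ n] at h
  exact (Nat.pow_le_pow_iff_right hp.out.one_lt).mp h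

/-- ★★★ **THE RELATION DOOR (every layer, `μ = 0`, `λ ≤ d`).**  `κ` a `ℤ_p`-extension with Fukuda index `0` (`TotallyRamifiedFrom κ 0`), a layer `n` with
**`d + 2 ≤ p^n`**, and the data of `classGroupPRank_le_of_relation` at layer `n` (`p² ∤ #`ambiguous classes, `c ∉ Cl^{σ−1}·Cl^p`, one relation of order `d` at
`σ = 1` mod `p`).  THEN **`rank_p Cl(K_m) ≤ d` for every `m`, `μ(κ) = 0` and `λ(κ) ≤ d`** (the one-layer small-rank criterion L10 at layer `n`:
`rank_p Cl(K_n) ≤ d < p^n − 1`). [cite: Washington1997, §13.3 Prop. 13.22–13.23] [cite: Fukuda1994, Thm. 1, p. 264] -/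
theorem classicalMuVanishes_and_classicalLambda_le_of_relation (κ : ZpExtension K p) (hκ : TotallyRamifiedFrom κ 0) {n : ℕ}
    (σ : (κ.layer n) ≃ₐ[K] (κ.layer n)) (hσ : ∀ τ : (κ.layer n) ≃ₐ[K] (κ.layer n), τ ∈ Subgroup.zpowers σ)
    (hfix : ¬ p ^ 2 ∣ Nat.card {c : ClassGroup (𝓞 (κ.layer n)) //
        ∀ τ : (κ.layer n) ≃ₐ[K] (κ.layer n), ClassGroup.mulEquiv (AmbiguousClass.intAut τ) c = c})
    {c : ClassGroup (𝓞 (κ.layer n))}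
    (hc : ¬ ∃ b e : ClassGroup (𝓞 (κ.layer n)), c = ClassGroup.mulEquiv (AmbiguousClass.intAut σ) b / b * e ^ p)
    {N d : ℕ} (hd : d + 2 ≤ p ^ n) {f : ℕ → ℤ} {u g : ℤ[X]} (hu : ¬ (p : ℤ) ∣ u.eval 1)
    (hF : (∑ i ∈ range N, C (f i) * X ^ i : ℤ[X]) = (X - 1) ^ d * u + C (p : ℤ) * g)
    (hrel : ∏ i ∈ range N, (ClassGroup.mulEquiv (AmbiguousClass.intAut (σ ^ i)) c) ^ (f i) = 1) :
    (∀ m, classGroupPRank κ m ≤ d) ∧ ClassicalMuVanishes κ ∧ classicalLambda κ ≤ d := by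
  have hn := classGroupPRank_le_of_relation κ n σ hσ hfix hc hu hF hrel
  have hsmall : classGroupPRank κ (0 + n) < p ^ n - 1 := by rw [Nat.zero_add]; omega
  have hall : ∀ m, classGroupPRank κ m ≤ d := fun m => by
    have h := classGroupPRank_le_of_lt_pow_sub_one κ hκ le_rfl hsmall m
    rw [Nat.zero_add, Nat.zero_add] at h
    exact h.trans hn
  exact ⟨hall, classicalLambda_le_of_forall_classGroupPRank_le κ hκ (n := 0) le_rfl (B := d) fun m _ => hall m⟩

/-- ★★★ **THE RELATION DOOR with Fukuda index `n₀` (every layer, `μ = 0`, `λ ≤ d`).**  `κ` a `ℤ_p`-extension totally ramified at every ramified prime from layer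
`n₀` (`TotallyRamifiedFrom κ n₀`), a layer `n₀ + j` with **`d + 2 ≤ p^j`**, and the data of `classGroupPRank_le_of_relation` at layer `n₀ + j` (`p² ∤ #`ambiguous classes,
`c ∉ Cl^{σ−1}·Cl^p`, one relation of order `d` at `σ = 1` mod `p`).  THEN **`rank_p Cl(K_m) ≤ d` for every `m ≥ n₀`, `μ(κ) = 0` and `λ(κ) ≤ d`** (the one-layer small-rank
criterion L10 above layer `n₀`).  Habitat: bases where ramification in the tower starts at layer `n₀ ≥ 1` (e.g. a dyadic prime with `K_𝔭 = ℚ₂(√2)`).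
[cite: Washington1997, §13.3 Prop. 13.22–13.23] [cite: Fukuda1994, Thm. 1, p. 264] -/
theorem classicalMuVanishes_and_classicalLambda_le_of_relation_index (κ : ZpExtension K p) {n₀ : ℕ} (hκ : TotallyRamifiedFrom κ n₀)
    {j : ℕ} (σ : (κ.layer (n₀ + j)) ≃ₐ[K] (κ.layer (n₀ + j)))
    (hσ : ∀ τ : (κ.layer (n₀ + j)) ≃ₐ[K] (κ.layer (n₀ + j)), τ ∈ Subgroup.zpowers σ)
    (hfix : ¬ p ^ 2 ∣ Nat.card {c : ClassGroup (𝓞 (κ.layer (n₀ + j))) //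
        ∀ τ : (κ.layer (n₀ + j)) ≃ₐ[K] (κ.layer (n₀ + j)), ClassGroup.mulEquiv (AmbiguousClass.intAut τ) c = c})
    {c : ClassGroup (𝓞 (κ.layer (n₀ + j)))}
    (hc : ¬ ∃ b e : ClassGroup (𝓞 (κ.layer (n₀ + j))), c = ClassGroup.mulEquiv (AmbiguousClass.intAut σ) b / b * e ^ p)
    {N d : ℕ} (hd : d + 2 ≤ p ^ j) {f : ℕ → ℤ} {u g : ℤ[X]} (hu : ¬ (p : ℤ) ∣ u.eval 1)
    (hF : (∑ i ∈ range N, C (f i) * X ^ i : ℤ[X]) = (X - 1) ^ d * u + C (p : ℤ) * g)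
    (hrel : ∏ i ∈ range N, (ClassGroup.mulEquiv (AmbiguousClass.intAut (σ ^ i)) c) ^ (f i) = 1) :
    (∀ m, n₀ ≤ m → classGroupPRank κ m ≤ d) ∧ ClassicalMuVanishes κ ∧ classicalLambda κ ≤ d := by
  have hn := classGroupPRank_le_of_relation κ (n₀ + j) σ hσ hfix hc hu hF hrel
  have hsmall : classGroupPRank κ (n₀ + j) < p ^ j - 1 := by omega
  have hall : ∀ m, n₀ ≤ m → classGroupPRank κ m ≤ d := fun m hm => by
    obtain ⟨k, rfl⟩ : ∃ k, m = n₀ + k := ⟨m - n₀, by omega⟩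
    exact (classGroupPRank_le_of_lt_pow_sub_one κ hκ le_rfl hsmall k).trans hn
  exact ⟨hall, classicalLambda_le_of_forall_classGroupPRank_le κ hκ (n := n₀) le_rfl (B := d) hall⟩

end Door

end Literature.NumberTheory.IwasawaTheory

end
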